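import Mathlib.Tactic.Abel
import Literature.MathematicalPhysics.QuantumFieldTheory.TorusChart
import HarnessLib

/-!
# Cochains on charted tori: coboundaries in degrees `0` and `1`, line sums, discrete Stokes, the axial primitive

Discrete exterior calculus in degrees `0` and `1` on a charted torus (`TorusChart.lean`) with coefficients in an
additive abelian group `A` (`ℝ`-valued phase gradients, `ℤ`-valued vorticities, angles `Real.Angle`, …):

* `TorusChart.d₀ f (x, i) = f (x + e_i) - f x` and
  `TorusChart.d₁ θ (x; i, j) = θ (x, i) + θ (x + e_i, j) - θ (x + e_j, i) - θ (x, j)` (the circulation of the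
  `1`-cochain `θ` around the plaquette `(x; i, j)`); `d₁_d₀ : d₁ (d₀ f) = 0`; flat cochains `IsFlat θ`
  (`d₁ θ = 0`) form a subgroup containing the gradients.
* `lineSum θ i n y = Σ_{k < n} θ (y + k • e_i, i)` with telescoping `lineSum_d₀` and the **sliding lemma**
  `lineSum_add_gen` (discrete Stokes for a ladder: flatness slides an edge across a straight line), whence loop
  sums of flat cochains are translation invariant (`lineSum_period_eq`).
* Change of coefficients along an additive monoid hom (`map_d₀`, `map_d₁`, `IsFlat.map`, `map_lineSum`).
* `prim θ` — the **axial primitive**, the sum of `θ` along the lexicographic staircase from `0` to `x`, and its key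
  property `d₀_prim_of_lt`: for a flat `θ`, `d₀ (prim θ)` agrees with `θ` on every NON-WRAPPING edge
  (`x_i + 1 < N_i`).  The wrapping edges are the subject of `TorusChartFlatCochains.lean`.

This is the additive, abelian and anisotropic form of the axial-gauge computation of
`FlatLatticeGaugeFields.lean` (isotropic torus, arbitrary group).
-/

namespace Literature.MathematicalPhysics.QuantumFieldTheory

open scoped BigOperators

namespace TorusChart

variable {Λ : Type*} [AddCommGroup Λ] {d : ℕ} (F : TorusChart Λ d)

/-! ## Cochains and coboundaries in degrees `0` and `1` -/

variable {A : Type*} [AddCommGroup A]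

/-- The coboundary of a `0`-cochain: `d₀ f (x, i) = f (x + e_i) - f x` (the gradient along the edge `(x, i)`).
[folklore] -/
def d₀ (f : Λ → A) : Λ → Fin d → A := fun x i => f (x + F.gen i) - f x

/-- The coboundary of a `1`-cochain: the circulation around the plaquette `(x; i, j)`,
`d₁ θ (x, i, j) = θ (x, i) + θ (x + e_i, j) - θ (x + e_j, i) - θ (x, j)`. [folklore] -/
def d₁ (θ : Λ → Fin d → A) : Λ → Fin d → Fin d → A :=
  fun x i j => θ x i + θ (x + F.gen i) j - θ (x + F.gen j) i - θ x j

/-- A `1`-cochain is **flat** (closed) if all its plaquette circulations vanish. [folklore] -/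
def IsFlat (θ : Λ → Fin d → A) : Prop := ∀ x i j, F.d₁ θ x i j = 0

/-- Unfolding `d₀`. [folklore] -/
@[simp] theorem d₀_apply (f : Λ → A) (x : Λ) (i : Fin d) : F.d₀ f x i = f (x + F.gen i) - f x := rfl

/-- Unfolding `d₁`. [folklore] -/
@[simp] theorem d₁_apply (θ : Λ → Fin d → A) (x : Λ) (i j : Fin d) :
    F.d₁ θ x i j = θ x i + θ (x + F.gen i) j - θ (x + F.gen j) i - θ x j := rfl

/-- `d₀` is additive. [folklore] -/
theorem d₀_add (f g : Λ → A) : F.d₀ (f + g) = F.d₀ f + F.d₀ g := by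
  funext x i; simp only [d₀_apply, Pi.add_apply]; abel

/-- `d₀` commutes with negation. [folklore] -/
theorem d₀_neg (f : Λ → A) : F.d₀ (-f) = -F.d₀ f := by
  funext x i; simp only [d₀_apply, Pi.neg_apply]; abel

/-- `d₀` is subtractive. [folklore] -/
theorem d₀_sub (f g : Λ → A) : F.d₀ (f - g) = F.d₀ f - F.d₀ g := by
  funext x i; simp only [d₀_apply, Pi.sub_apply]; abel

/-- `d₀ 0 = 0`. [folklore] -/
@[simp] theorem d₀_zero : F.d₀ (0 : Λ → A) = 0 := by
  funext x i; simp

/-- Constants have zero gradient. [folklore] -/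
@[simp] theorem d₀_const (a : A) : F.d₀ (fun _ : Λ => a) = 0 := by
  funext x i; simp

/-- `d₁` is additive. [folklore] -/
theorem d₁_add (θ η : Λ → Fin d → A) : F.d₁ (θ + η) = F.d₁ θ + F.d₁ η := by
  funext x i j; simp only [d₁_apply, Pi.add_apply]; abel

/-- `d₁` commutes with negation. [folklore] -/
theorem d₁_neg (θ : Λ → Fin d → A) : F.d₁ (-θ) = -F.d₁ θ := by
  funext x i j; simp only [d₁_apply, Pi.neg_apply]; abel

/-- `d₁` is subtractive. [folklore] -/
theorem d₁_sub (θ η : Λ → Fin d → A) : F.d₁ (θ - η) = F.d₁ θ - F.d₁ η := by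
  funext x i j; simp only [d₁_apply, Pi.sub_apply]; abel

/-- `d₁ 0 = 0`. [folklore] -/
@[simp] theorem d₁_zero : F.d₁ (0 : Λ → Fin d → A) = 0 := by
  funext x i j; simp

/-- `d₁` is alternating: the diagonal vanishes. [folklore] -/
theorem d₁_self (θ : Λ → Fin d → A) (x : Λ) (i : Fin d) : F.d₁ θ x i i = 0 := by
  simp only [d₁_apply]; abel

/-- `d₁` is alternating: antisymmetry. [folklore] -/
theorem d₁_swap (θ : Λ → Fin d → A) (x : Λ) (i j : Fin d) : F.d₁ θ x j i = -F.d₁ θ x i j := by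
  simp only [d₁_apply]; abel

/-- **`d ∘ d = 0`**: gradients are flat (the unit translations commute). [folklore] -/
theorem d₁_d₀ (f : Λ → A) : F.d₁ (F.d₀ f) = 0 := by
  funext x i j
  simp only [d₁_apply, d₀_apply, Pi.zero_apply, add_right_comm x (F.gen i) (F.gen j)]
  abel

/-- Gradients are flat. [folklore] -/
theorem isFlat_d₀ (f : Λ → A) : F.IsFlat (F.d₀ f) := fun x i j => by
  rw [d₁_d₀]; rfl

variable {F} in
/-- Flat cochains form a subgroup: sums. [folklore] -/
theorem IsFlat.add {θ η : Λ → Fin d → A} (hθ : F.IsFlat θ) (hη : F.IsFlat η) : F.IsFlat (θ + η) :=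
  fun x i j => by rw [d₁_add, Pi.add_apply, Pi.add_apply, Pi.add_apply, hθ, hη, add_zero]

variable {F} in
/-- Flat cochains form a subgroup: negation. [folklore] -/
theorem IsFlat.neg {θ : Λ → Fin d → A} (hθ : F.IsFlat θ) : F.IsFlat (-θ) :=
  fun x i j => by rw [d₁_neg, Pi.neg_apply, Pi.neg_apply, Pi.neg_apply, hθ, neg_zero]

variable {F} in
/-- Flat cochains form a subgroup: differences. [folklore] -/
theorem IsFlat.sub {θ η : Λ → Fin d → A} (hθ : F.IsFlat θ) (hη : F.IsFlat η) : F.IsFlat (θ - η) :=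
  fun x i j => by rw [d₁_sub, Pi.sub_apply, Pi.sub_apply, Pi.sub_apply, hθ, hη, sub_zero]

/-- The zero cochain is flat. [folklore] -/
theorem isFlat_zero : F.IsFlat (0 : Λ → Fin d → A) := fun x i j => by rw [d₁_zero]; rfl

variable {F} in
/-- Flatness at the plaquette `(y; μ, ν)` in "sliding" form:
`θ (y, μ) + θ (y + e_μ, ν) = θ (y, ν) + θ (y + e_ν, μ)`. [folklore] -/
theorem IsFlat.add_eq_add {θ : Λ → Fin d → A} (hθ : F.IsFlat θ) (y : Λ) (μ ν : Fin d) :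
    θ y μ + θ (y + F.gen μ) ν = θ y ν + θ (y + F.gen ν) μ := by
  have h := hθ y μ ν
  rw [d₁_apply, sub_sub, sub_eq_zero] at h
  rw [h, add_comm]

/-! ## Line sums and discrete Stokes -/

/-- **Line sum**: `lineSum θ i n y = Σ_{k < n} θ (y + k • e_i, i)`, the sum of `θ` along `n` consecutive edges in
direction `i` starting at `y`. [folklore] -/
def lineSum (θ : Λ → Fin d → A) (i : Fin d) (n : ℕ) (y : Λ) : A :=
  ∑ k ∈ Finset.range n, θ (y + k • F.gen i) i

/-- The empty line sum. [folklore] -/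
@[simp] theorem lineSum_zero (θ : Λ → Fin d → A) (i : Fin d) (y : Λ) : F.lineSum θ i 0 y = 0 := by
  simp [lineSum]

/-- One more edge at the end of the line. [folklore] -/
theorem lineSum_succ (θ : Λ → Fin d → A) (i : Fin d) (n : ℕ) (y : Λ) :
    F.lineSum θ i (n + 1) y = F.lineSum θ i n y + θ (y + n • F.gen i) i := by
  simp [lineSum, Finset.sum_range_succ]

/-- One more edge at the start of the line. [folklore] -/
theorem lineSum_succ' (θ : Λ → Fin d → A) (i : Fin d) (n : ℕ) (y : Λ) :
    F.lineSum θ i (n + 1) y = θ y i + F.lineSum θ i n (y + F.gen i) := by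
  simp only [lineSum, Finset.sum_range_succ', zero_smul, add_zero, add_assoc, ← succ_nsmul']
  rw [add_comm]

/-- Line sums are additive in the cochain. [folklore] -/
theorem lineSum_add (θ η : Λ → Fin d → A) (i : Fin d) (n : ℕ) (y : Λ) :
    F.lineSum (θ + η) i n y = F.lineSum θ i n y + F.lineSum η i n y := by
  simp [lineSum, Finset.sum_add_distrib]

/-- Line sums are subtractive in the cochain. [folklore] -/
theorem lineSum_sub (θ η : Λ → Fin d → A) (i : Fin d) (n : ℕ) (y : Λ) :
    F.lineSum (θ - η) i n y = F.lineSum θ i n y - F.lineSum η i n y := by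
  simp [lineSum, Finset.sum_sub_distrib]

/-- Concatenation of lines. [folklore] -/
theorem lineSum_add_length (θ : Λ → Fin d → A) (i : Fin d) (m n : ℕ) (y : Λ) :
    F.lineSum θ i (m + n) y = F.lineSum θ i m y + F.lineSum θ i n (y + m • F.gen i) := by
  induction n with
  | zero => simp
  | succ n ih => rw [← add_assoc, lineSum_succ, ih, lineSum_succ, add_assoc, add_assoc, add_smul]

/-- **Telescoping**: the line sum of a gradient is the difference of the endpoint values. [folklore] -/
theorem lineSum_d₀ (f : Λ → A) (i : Fin d) (n : ℕ) (y : Λ) :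
    F.lineSum (F.d₀ f) i n y = f (y + n • F.gen i) - f y := by
  induction n with
  | zero => simp
  | succ n ih => rw [lineSum_succ, ih, d₀_apply, add_assoc, ← succ_nsmul]; abel

variable {F} in
/-- **Sliding lemma (discrete Stokes for a ladder).** For a flat `θ`, an edge in direction `μ` slides across
`n` steps in direction `ν`: `θ (y, μ) + L_ν(n; y + e_μ) = L_ν(n; y) + θ (y + n • e_ν, μ)`. [folklore] -/
theorem lineSum_add_gen {θ : Λ → Fin d → A} (hθ : F.IsFlat θ) (μ ν : Fin d) :
    ∀ (n : ℕ) (y : Λ), θ y μ + F.lineSum θ ν n (y + F.gen μ) = F.lineSum θ ν n y + θ (y + n • F.gen ν) μ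
  | 0, y => by simp
  | n + 1, y => by
    have IH := lineSum_add_gen hθ μ ν n (y + F.gen ν)
    have hflat := hθ.add_eq_add y μ ν
    rw [lineSum_succ', lineSum_succ', succ_nsmul', ← add_assoc y (F.gen ν) (n • F.gen ν),
      add_right_comm y (F.gen μ) (F.gen ν)]
    calc θ y μ + (θ (y + F.gen μ) ν + F.lineSum θ ν n (y + F.gen ν + F.gen μ))
        = (θ y μ + θ (y + F.gen μ) ν) + F.lineSum θ ν n (y + F.gen ν + F.gen μ) := (add_assoc _ _ _).symm
      _ = (θ y ν + θ (y + F.gen ν) μ) + F.lineSum θ ν n (y + F.gen ν + F.gen μ) := by rw [hflat]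
      _ = θ y ν + (θ (y + F.gen ν) μ + F.lineSum θ ν n (y + F.gen ν + F.gen μ)) := add_assoc _ _ _
      _ = θ y ν + (F.lineSum θ ν n (y + F.gen ν) + θ (y + F.gen ν + n • F.gen ν) μ) := by rw [IH]
      _ = θ y ν + F.lineSum θ ν n (y + F.gen ν) + θ (y + F.gen ν + n • F.gen ν) μ := (add_assoc _ _ _).symm

variable {F} in
/-- **Loop sums of a flat cochain are translation invariant**: the sum of a flat `θ` around a full axis loop
(`N_ν` consecutive `ν`-edges) does not change when the loop is translated by `e_μ`. [folklore] -/
theorem lineSum_period_add_gen {θ : Λ → Fin d → A} (hθ : F.IsFlat θ) (μ ν : Fin d) (y : Λ) :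
    F.lineSum θ ν (F.period ν) (y + F.gen μ) = F.lineSum θ ν (F.period ν) y := by
  have h := F.lineSum_add_gen hθ μ ν (F.period ν) y
  rw [add_period_nsmul_gen, add_comm (F.lineSum θ ν _ y)] at h
  exact add_left_cancel h

variable {F} in
/-- Loop sums of a flat cochain are invariant under all translations by multiples of unit translations.
[folklore] -/
theorem lineSum_period_add_nsmul_gen {θ : Λ → Fin d → A} (hθ : F.IsFlat θ) (μ ν : Fin d) (y : Λ) :
    ∀ n : ℕ, F.lineSum θ ν (F.period ν) (y + n • F.gen μ) = F.lineSum θ ν (F.period ν) y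
  | 0 => by simp
  | n + 1 => by rw [succ_nsmul, ← add_assoc, lineSum_period_add_gen hθ, lineSum_period_add_nsmul_gen hθ μ ν y n]

variable {F} in
/-- **Loop sums of a flat cochain do not depend on the base point.** [folklore] -/
theorem lineSum_period_eq {θ : Λ → Fin d → A} (hθ : F.IsFlat θ) (ν : Fin d) (y : Λ) :
    F.lineSum θ ν (F.period ν) y = F.lineSum θ ν (F.period ν) 0 := by
  rw [F.eq_sum_cval_nsmul_gen y]
  induction (Finset.univ : Finset (Fin d)) using Finset.induction_on with
  | empty => simp
  | insert a s ha ih => rw [Finset.sum_insert ha, add_comm, ← zero_add (_ + _), ← add_assoc,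
      lineSum_period_add_nsmul_gen hθ, zero_add, ih]


/-! ## Change of coefficients -/

section Map

variable {B : Type*} [AddCommGroup B] (g : A →+ B)

/-- `d₀` commutes with a change of coefficients. [folklore] -/
theorem map_d₀ (f : Λ → A) (x : Λ) (i : Fin d) : g (F.d₀ f x i) = F.d₀ (fun y => g (f y)) x i := by
  simp only [d₀_apply, map_sub]

/-- `d₁` commutes with a change of coefficients. [folklore] -/
theorem map_d₁ (θ : Λ → Fin d → A) (x : Λ) (i j : Fin d) :
    g (F.d₁ θ x i j) = F.d₁ (fun y k => g (θ y k)) x i j := by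
  simp only [d₁_apply, map_sub, map_add]

variable {F} in
/-- Flatness is preserved by a change of coefficients. [folklore] -/
theorem IsFlat.map {θ : Λ → Fin d → A} (hθ : F.IsFlat θ) : F.IsFlat fun y k => g (θ y k) :=
  fun x i j => by rw [← map_d₁, hθ, map_zero]

/-- Line sums commute with a change of coefficients. [folklore] -/
theorem map_lineSum (θ : Λ → Fin d → A) (i : Fin d) (n : ℕ) (y : Λ) :
    g (F.lineSum θ i n y) = F.lineSum (fun z k => g (θ z k)) i n y := by
  simp only [lineSum, map_sum]

end Map

/-! ## The axial primitive -/

/-- **Axial primitive after `k` directions**: the sum of `θ` along the lexicographic axial staircase from the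
origin towards `x` — `x₀` edges in direction `0`, then `x₁` edges in direction `1`, … — stopped after the first
`k` directions. [folklore] -/
noncomputable def axPrim (θ : Λ → Fin d → A) (x : Λ) : ℕ → A
  | 0 => 0
  | k + 1 => axPrim θ x k + (if hk : k < d then F.lineSum θ ⟨k, hk⟩ (F.cval ⟨k, hk⟩ x) (F.trunc k x) else 0)

/-- **The axial primitive** `prim θ x`: the sum of the `1`-cochain `θ` along the full lexicographic axial
staircase from `0` to `x` (a `0`-cochain; the additive "axial gauge"). [folklore] -/
noncomputable def prim (θ : Λ → Fin d → A) (x : Λ) : A := F.axPrim θ x d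

/-- The staircase sum after no direction. [folklore] -/
@[simp] theorem axPrim_zero (θ : Λ → Fin d → A) (x : Λ) : F.axPrim θ x 0 = 0 := rfl

/-- The staircase sum after one more direction. [folklore] -/
theorem axPrim_succ (θ : Λ → Fin d → A) (x : Λ) (k : ℕ) :
    F.axPrim θ x (k + 1) =
      F.axPrim θ x k + (if hk : k < d then F.lineSum θ ⟨k, hk⟩ (F.cval ⟨k, hk⟩ x) (F.trunc k x) else 0) := rfl

/-- The axial primitive vanishes at the origin. [folklore] -/
@[simp] theorem axPrim_origin (θ : Λ → Fin d → A) : ∀ k, F.axPrim θ 0 k = 0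
  | 0 => rfl
  | k + 1 => by
    rw [axPrim_succ, axPrim_origin θ k, zero_add]
    split_ifs with hk
    · rw [F.cval_zero, lineSum_zero]
    · rfl

/-- The axial primitive vanishes at the origin. [folklore] -/
@[simp] theorem prim_origin (θ : Λ → Fin d → A) : F.prim θ 0 = 0 := F.axPrim_origin θ d

/-- The axial primitive is additive in the cochain. [folklore] -/
theorem axPrim_add (θ η : Λ → Fin d → A) (x : Λ) : ∀ k, F.axPrim (θ + η) x k = F.axPrim θ x k + F.axPrim η x k
  | 0 => by simp
  | k + 1 => by
    rw [axPrim_succ, axPrim_succ, axPrim_succ, axPrim_add θ η x k]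
    split_ifs with hk
    · rw [lineSum_add]; abel
    · abel

/-- The axial primitive is additive in the cochain. [folklore] -/
theorem prim_add (θ η : Λ → Fin d → A) : F.prim (θ + η) = F.prim θ + F.prim η := by
  funext x; exact F.axPrim_add θ η x d

variable {F} in
/-- **Axial primitive of a non-wrapping translate (discrete Stokes).** For a flat `θ` and a non-wrapping edge
`(x, μ)` (`x_μ + 1 < N_μ`), after `k` directions the staircase sum towards `x + e_μ` is the one towards `x`
plus the edge `(corner_k, μ)` as soon as direction `μ` has been traversed. [folklore] -/
theorem axPrim_add_gen {θ : Λ → Fin d → A} (hθ : F.IsFlat θ) (x : Λ) (μ : Fin d)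
    (hx : F.cval μ x + 1 < F.period μ) :
    ∀ k : ℕ, F.axPrim θ (x + F.gen μ) k = F.axPrim θ x k + (if (μ : ℕ) < k then θ (F.trunc k x) μ else 0)
  | 0 => by simp
  | k + 1 => by
    have IH := axPrim_add_gen hθ x μ hx k
    rw [axPrim_succ, axPrim_succ, IH]
    by_cases hkd : k < d
    · simp only [dif_pos hkd]
      set κ : Fin d := ⟨k, hkd⟩ with hκ
      rcases lt_trichotomy (μ : ℕ) k with hlt | heq | hgt
      · -- direction `μ` already traversed: slide the `μ`-edge across the `κ`-line
        have hμκ : μ ≠ κ := fun h => by rw [h] at hlt; exact lt_irrefl _ hlt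
        have hlt' : (μ : ℕ) < k + 1 := Nat.lt_succ_of_lt hlt
        rw [if_pos hlt, if_pos hlt', F.trunc_add_gen_of_lt k x μ hx, if_pos hlt, F.trunc_succ hkd,
          F.cval_add_gen_of_ne x (Ne.symm hμκ)]
        have hslide := F.lineSum_add_gen hθ μ κ (F.cval κ x) (F.trunc k x)
        -- `a + θ t μ + L(t + e_μ) = a + L t + θ (t + n e_κ) μ`
        rw [add_assoc, hslide, add_assoc]
      · -- direction `μ` is direction `k`: one more edge at the end of the `μ`-line
        have hμκ : μ = κ := Fin.ext heq
        subst hμκ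
        rw [if_neg (lt_irrefl _), if_pos (Nat.lt_succ_self _), add_zero, F.trunc_add_gen_of_lt k x _ hx,
          if_neg (lt_irrefl _), add_zero, F.cval_add_gen_self_of_lt _ _ hx, lineSum_succ, F.trunc_succ hkd,
          add_assoc]
      · -- direction `μ` not yet traversed: nothing changes
        have hμκ : μ ≠ κ := fun h => by rw [h] at hgt; exact lt_irrefl _ hgt
        have h1 : ¬ (μ : ℕ) < k := by omega
        have h2 : ¬ (μ : ℕ) < k + 1 := by omega
        rw [if_neg h1, if_neg h2, add_zero, add_zero, F.trunc_add_gen_of_lt k x μ hx, if_neg h1, add_zero,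
          F.cval_add_gen_of_ne x (Ne.symm hμκ)]
    · -- all directions traversed: both corners are `x` itself
      simp only [dif_neg hkd, add_zero]
      have hdk : d ≤ k := not_lt.1 hkd
      have h2 : (μ : ℕ) < k + 1 := by have := μ.isLt; omega
      have h3 : (μ : ℕ) < k := by have := μ.isLt; omega
      rw [if_pos h3, if_pos h2, F.trunc_of_le hdk, F.trunc_of_le (Nat.le_succ_of_le hdk)]

variable {F} in
/-- **The axial primitive integrates `θ` on non-wrapping edges**: for a flat `θ`,
`d₀ (prim θ) (x, μ) = θ (x, μ)` whenever `x_μ + 1 < N_μ`. [folklore] -/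
theorem d₀_prim_of_lt {θ : Λ → Fin d → A} (hθ : F.IsFlat θ) (x : Λ) (μ : Fin d)
    (hx : F.cval μ x + 1 < F.period μ) : F.d₀ (F.prim θ) x μ = θ x μ := by
  have h := axPrim_add_gen hθ x μ hx d
  rw [if_pos μ.isLt, F.trunc_of_le le_rfl] at h
  rw [d₀_apply, prim, prim, h, add_sub_cancel_left]

end TorusChart

end Literature.MathematicalPhysics.QuantumFieldTheory
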